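import Mathlib
import HarnessLib
import Summits.Ventures.LatticeQCDFlow.Scoring.UStatisticProjectionsIntegral

/-!
# LatticeQCDFlow / Scoring — the variance of the unbiased sample variance of `n` i.i.d. draws on a
# GENERAL space: `Var S² = ((n − 1)μ₄ − (n − 3)σ⁴)/(n(n − 1))` EXACTLY

HONEST FRAMING: exact (Metropolis-corrected) sampling algorithms for lattice gauge theory;
figures of merit are autocorrelation/cost numbers at stated couplings and volumes; no
continuum-physics claim.

Venture `LatticeQCDFlow` (cell pub-lqcd), sub-topic `Scoring`; FANOUT row 3 (`s0-u1-a`, S0-B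
implementation A, GEN-10).  The MEASURE-THEORETIC form of row 3's `Scoring/WeightVarianceStatistic`
(GEN-8: finite configuration space, the weight-variance statistic behind the ESS monitor) — our
formalisation of a PUBLISHED identity, the classical variance of the unbiased sample variance
`Var s² = (μ₄ − σ⁴(n − 3)/(n − 1))/n` (e.g. Cramér, *Mathematical Methods of Statistics* (1946)
§27.4; Kenney–Keeping), NAMED ONLY as the printed counterpart, obtained here as the kernel
`(g − g′)²/2` inserted in row 3's general-space Hoeffding law (`Scoring/UStatisticVarianceIntegral`,
via `Scoring/UStatisticProjectionsIntegral`, imported).  NO definition is introduced.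

## Setting

An abstract probability space `(Ω, P)`; draws `x_i : Ω → X` (`i : Fin n`) into any measurable
space, `iIndepFun` with common law `ν`; a real observable `g : X → ℝ` with `g ∈ L⁴(ν)`;
`m = ∫ g dν`, `σ² = ∫ (g − m)² dν`, `μ₄ = ∫ (g − m)⁴ dν`;
`S² = Σ_{(i,j) ∈ offDiag} (g(x_i) − g(x_j))²/2 / (n(n − 1))` — the unbiased sample variance
(`= Σ_i (g(x_i) − ḡ)²/(n − 1)`).  For the flow sampler: `g = w = p/q` under the model, `σ² =
Var_q w = 1/ESS − 1` (row 3's `Scoring/AcceptanceMonitorConcentrationIntegral`).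

* §1 a CENTRED observable `u ∈ L⁴(ν)`, `∫ u = 0` (`σ² = ∫u²`, `μ₄ = ∫u⁴`): integrability
  bookkeeping, `integral_halfSqDiff_centred` (`∫ (u − u′)²/2 d(ν⊗ν) = σ²`),
  `integral_halfSqDiff_sq_centred` (`c₂ = ∫ ((u − u′)²/2)² = (μ₄ + 3σ⁴)/2`),
  `condMean_halfSqDiff_centred` (`h(a) = (u(a)² + σ²)/2`), `integral_condMean_sq_centred`
  (`c₁ = (μ₄ + 3σ⁴)/4`), `memLp_halfSqDiff_two_centred`;
* §2 a general `g ∈ L⁴(ν)` (centring `u = g − m` does not change the kernel):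
  `integral_sampleVar_iid` (`E S² = σ²`), **`variance_sampleVar_iid`** —
  `Var[S²] = ((n − 1)μ₄ − (n − 3)σ⁴)/(n(n − 1))`, **`variance_sampleVar_iid'`** —
  `= (μ₄ − σ⁴)/n + 2σ⁴/(n(n − 1))`, and `sq_variance_le_fourthMoment` (`σ⁴ ≤ μ₄`).

NOT CLAIMED: the law of the self-normalised ESS monitor (a ratio); nothing about any statistic of
ours.
-/

namespace Summit.Ventures.LatticeQCDFlow.Scoring

open MeasureTheory ProbabilityTheory Finset

/-! ### §1 A centred observable in `L⁴` -/

section Centred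

variable {X : Type*} [MeasurableSpace X] {ν : Measure X} [IsProbabilityMeasure ν] {u : X → ℝ}

/-- `u ∈ L⁴(ν)` on a probability space ⇒ `u`, `u²`, `u³`, `u⁴` are `ν`-integrable. [folklore] -/
theorem integrable_pows_of_memLp_four (hu4 : MemLp u 4 ν) :
    Integrable u ν ∧ Integrable (fun a => u a ^ 2) ν ∧ Integrable (fun a => u a ^ 3) ν ∧
      Integrable (fun a => u a ^ 4) ν := by
  have h1 : Integrable u ν :=
    memLp_one_iff_integrable.1 (hu4.mono_exponent (by norm_num : (1 : ENNReal) ≤ 4))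
  have h2 : Integrable (fun a => u a ^ 2) ν :=
    (hu4.mono_exponent (by norm_num : (2 : ENNReal) ≤ 4)).integrable_sq
  have h3 : Integrable (fun a => u a ^ 3) ν := by
    have h := (hu4.mono_exponent (by norm_num : (3 : ENNReal) ≤ 4)).integrable_norm_pow' (p := 3)
    refine h.mono' (h1.aestronglyMeasurable.pow 3) (Filter.Eventually.of_forall fun a => ?_)
    rw [Real.norm_eq_abs, Real.norm_eq_abs, abs_pow]
  have h4 : Integrable (fun a => u a ^ 4) ν := by
    have h := hu4.integrable_norm_pow' (p := 4)
    refine h.congr (Filter.Eventually.of_forall fun a => ?_)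
    simp only [Real.norm_eq_abs]
    rw [← abs_pow, abs_of_nonneg (by positivity)]
  exact ⟨h1, h2, h3, h4⟩

/-- **`∫ (u − u′)²/2 d(ν ⊗ ν) = ∫ u² dν`** for a centred `u` (`∫ u = 0`). [folklore] -/
theorem integral_halfSqDiff_centred (hu4 : MemLp u 4 ν) (hu0 : ∫ a, u a ∂ν = 0) :
    ∫ z, (u z.1 - u z.2) ^ 2 / 2 ∂(ν.prod ν) = ∫ a, u a ^ 2 ∂ν := by
  obtain ⟨h1, h2, -, -⟩ := integrable_pows_of_memLp_four hu4
  have e : ∀ z : X × X, (u z.1 - u z.2) ^ 2 / 2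
      = u z.1 ^ 2 / 2 - u z.1 * u z.2 + u z.2 ^ 2 / 2 := fun z => by ring
  simp_rw [e]
  have iA : Integrable (fun z : X × X => u z.1 ^ 2 / 2) (ν.prod ν) := (h2.comp_fst ν).div_const 2
  have iB : Integrable (fun z : X × X => u z.1 * u z.2) (ν.prod ν) := h1.mul_prod h1
  have iC : Integrable (fun z : X × X => u z.2 ^ 2 / 2) (ν.prod ν) := (h2.comp_snd ν).div_const 2
  have iAB : Integrable (fun z : X × X => u z.1 ^ 2 / 2 - u z.1 * u z.2) (ν.prod ν) := iA.sub iB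
  rw [integral_add iAB iC, integral_sub iA iB, integral_prod_mul u u, hu0, mul_zero, sub_zero,
    integral_div, integral_div, integral_fun_fst (fun a => u a ^ 2),
    integral_fun_snd (fun a => u a ^ 2), probReal_univ, one_smul]
  ring

/-- **`c₂` for the kernel `(u − u′)²/2`**: `∫ ((u − u′)²/2)² d(ν ⊗ ν) = (μ₄ + 3σ⁴)/2` for a centred
`u` (`(u − u′)⁴ = u⁴ − 4u³u′ + 6u²u′² − 4uu′³ + u′⁴`, the odd terms integrate to `0`). [folklore] -/
theorem integral_halfSqDiff_sq_centred (hu4 : MemLp u 4 ν) (hu0 : ∫ a, u a ∂ν = 0) :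
    ∫ z, ((u z.1 - u z.2) ^ 2 / 2) ^ 2 ∂(ν.prod ν)
      = ((∫ a, u a ^ 4 ∂ν) + 3 * (∫ a, u a ^ 2 ∂ν) ^ 2) / 2 := by
  obtain ⟨h1, h2, h3, h4⟩ := integrable_pows_of_memLp_four hu4
  have e : ∀ z : X × X, ((u z.1 - u z.2) ^ 2 / 2) ^ 2
      = u z.1 ^ 4 / 4 - u z.1 ^ 3 * u z.2 + 3 / 2 * (u z.1 ^ 2 * u z.2 ^ 2)
        - u z.1 * u z.2 ^ 3 + u z.2 ^ 4 / 4 := fun z => by ring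
  simp_rw [e]
  have iA : Integrable (fun z : X × X => u z.1 ^ 4 / 4) (ν.prod ν) := (h4.comp_fst ν).div_const 4
  have iB : Integrable (fun z : X × X => u z.1 ^ 3 * u z.2) (ν.prod ν) := h3.mul_prod h1
  have iC : Integrable (fun z : X × X => 3 / 2 * (u z.1 ^ 2 * u z.2 ^ 2)) (ν.prod ν) :=
    (h2.mul_prod h2).const_mul _
  have iD : Integrable (fun z : X × X => u z.1 * u z.2 ^ 3) (ν.prod ν) := h1.mul_prod h3
  have iE : Integrable (fun z : X × X => u z.2 ^ 4 / 4) (ν.prod ν) := (h4.comp_snd ν).div_const 4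
  have i2 : Integrable (fun z : X × X => u z.1 ^ 4 / 4 - u z.1 ^ 3 * u z.2) (ν.prod ν) := iA.sub iB
  have i3 : Integrable (fun z : X × X => u z.1 ^ 4 / 4 - u z.1 ^ 3 * u z.2
      + 3 / 2 * (u z.1 ^ 2 * u z.2 ^ 2)) (ν.prod ν) := i2.add iC
  have i4 : Integrable (fun z : X × X => u z.1 ^ 4 / 4 - u z.1 ^ 3 * u z.2
      + 3 / 2 * (u z.1 ^ 2 * u z.2 ^ 2) - u z.1 * u z.2 ^ 3) (ν.prod ν) := i3.sub iD
  rw [integral_add i4 iE, integral_sub i3 iD, integral_add i2 iC, integral_sub iA iB,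
    integral_const_mul, integral_prod_mul (fun a => u a ^ 3) u,
    integral_prod_mul (fun a => u a ^ 2) (fun a => u a ^ 2), integral_prod_mul u (fun a => u a ^ 3),
    hu0, integral_div, integral_div, integral_fun_fst (fun a => u a ^ 4),
    integral_fun_snd (fun a => u a ^ 4), probReal_univ, one_smul]
  ring

/-- **Hoeffding's projection of the kernel `(u − u′)²/2`**: for a centred `u` and every `a`,
`∫ (u(a) − u(b))²/2 dν(b) = (u(a)² + σ²)/2`. [folklore] -/
theorem condMean_halfSqDiff_centred (hu4 : MemLp u 4 ν) (hu0 : ∫ a, u a ∂ν = 0) (a : X) :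
    ∫ b, (u a - u b) ^ 2 / 2 ∂ν = (u a ^ 2 + ∫ b, u b ^ 2 ∂ν) / 2 := by
  obtain ⟨h1, h2, -, -⟩ := integrable_pows_of_memLp_four hu4
  have e : ∀ b, (u a - u b) ^ 2 / 2 = u a ^ 2 / 2 - u a * u b + u b ^ 2 / 2 := fun b => by ring
  simp_rw [e]
  have iA : Integrable (fun _ : X => u a ^ 2 / 2) ν := integrable_const _
  have iB : Integrable (fun b => u a * u b) ν := h1.const_mul _
  have iC : Integrable (fun b => u b ^ 2 / 2) ν := h2.div_const 2
  have iAB : Integrable (fun b => u a ^ 2 / 2 - u a * u b) ν := iA.sub iB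
  rw [integral_add iAB iC, integral_sub iA iB, integral_const_mul, hu0, mul_zero, sub_zero,
    integral_const, probReal_univ, one_smul, integral_div]
  ring

/-- **`c₁` for the kernel `(u − u′)²/2`**: `∫ (∫ (u(a) − u(b))²/2 dν(b))² dν(a) = (μ₄ + 3σ⁴)/4` for
a centred `u`. [folklore] -/
theorem integral_condMean_sq_centred (hu4 : MemLp u 4 ν) (hu0 : ∫ a, u a ∂ν = 0) :
    ∫ a, (∫ b, (u a - u b) ^ 2 / 2 ∂ν) ^ 2 ∂ν
      = ((∫ a, u a ^ 4 ∂ν) + 3 * (∫ a, u a ^ 2 ∂ν) ^ 2) / 4 := by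
  obtain ⟨-, h2, -, h4⟩ := integrable_pows_of_memLp_four hu4
  have hc : ∀ a, ∫ b, (u a - u b) ^ 2 / 2 ∂ν = (u a ^ 2 + ∫ b, u b ^ 2 ∂ν) / 2 :=
    condMean_halfSqDiff_centred hu4 hu0
  simp_rw [hc]
  set s := ∫ b, u b ^ 2 ∂ν with hs
  have e : ∀ a, ((u a ^ 2 + s) / 2) ^ 2 = u a ^ 4 / 4 + s / 2 * u a ^ 2 + s ^ 2 / 4 :=
    fun a => by ring
  simp_rw [e]
  have iA : Integrable (fun a => u a ^ 4 / 4) ν := h4.div_const 4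
  have iB : Integrable (fun a => s / 2 * u a ^ 2) ν := h2.const_mul _
  have iAB : Integrable (fun a => u a ^ 4 / 4 + s / 2 * u a ^ 2) ν := iA.add iB
  rw [integral_add iAB (integrable_const _), integral_add iA iB, integral_const_mul, integral_div,
    integral_const, probReal_univ, one_smul, ← hs]
  ring

/-- The kernel `(u − u′)²/2` of a (centred) `u ∈ L⁴(ν)` is in `L²(ν ⊗ ν)`. [folklore] -/
theorem memLp_halfSqDiff_two_centred (hum : Measurable u) (hu4 : MemLp u 4 ν) :
    MemLp (fun z : X × X => (u z.1 - u z.2) ^ 2 / 2) 2 (ν.prod ν) := by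
  obtain ⟨h1, h2, h3, h4⟩ := integrable_pows_of_memLp_four hu4
  have hm : Measurable fun z : X × X => (u z.1 - u z.2) ^ 2 / 2 :=
    (((hum.comp measurable_fst).sub (hum.comp measurable_snd)).pow_const 2).div_const 2
  rw [memLp_two_iff_integrable_sq hm.aestronglyMeasurable]
  have e : (fun z : X × X => ((u z.1 - u z.2) ^ 2 / 2) ^ 2)
      = fun z => u z.1 ^ 4 / 4 - u z.1 ^ 3 * u z.2 + 3 / 2 * (u z.1 ^ 2 * u z.2 ^ 2)
        - u z.1 * u z.2 ^ 3 + u z.2 ^ 4 / 4 := by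
    funext z; ring
  rw [e]
  exact (((((h4.comp_fst ν).div_const 4).sub (h3.mul_prod h1)).add
    ((h2.mul_prod h2).const_mul _)).sub (h1.mul_prod h3)).add ((h4.comp_snd ν).div_const 4)

end Centred

/-! ### §2 The sample variance of a general observable in `L⁴` -/

section SampleVar

variable {Ω : Type*} [MeasurableSpace Ω] {P : Measure Ω} [IsProbabilityMeasure P]
variable {X : Type*} [MeasurableSpace X] {ν : Measure X}
variable {n : ℕ} {x : Fin n → Ω → X}

/-- Centring: `u = g − m` is centred and in `L⁴(ν)`, and `(g − g′)²/2 = (u − u′)²/2`.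
[folklore] -/
theorem centred_of_memLp_four [IsProbabilityMeasure ν] {g : X → ℝ} (hg4 : MemLp g 4 ν) :
    MemLp (fun a => g a - ∫ b, g b ∂ν) 4 ν ∧ ∫ a, (g a - ∫ b, g b ∂ν) ∂ν = 0 := by
  refine ⟨hg4.sub (memLp_const _), ?_⟩
  rw [integral_sub
      (memLp_one_iff_integrable.1 (hg4.mono_exponent (by norm_num : (1 : ENNReal) ≤ 4)))
      (integrable_const _), integral_const, probReal_univ, one_smul, sub_self]

/-- The kernel `(g − g′)²/2` of `g ∈ L⁴(ν)` is measurable, symmetric and in `L²(ν ⊗ ν)`.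
[folklore] -/
theorem memLp_halfSqDiff_two [IsProbabilityMeasure ν] {g : X → ℝ} (hgm : Measurable g)
    (hg4 : MemLp g 4 ν) :
    MemLp (fun z : X × X => (g z.1 - g z.2) ^ 2 / 2) 2 (ν.prod ν) := by
  have h := memLp_halfSqDiff_two_centred (ν := ν) (hgm.sub_const (∫ b, g b ∂ν))
    (centred_of_memLp_four hg4).1
  have e : (fun z : X × X => ((g z.1 - ∫ b, g b ∂ν) - (g z.2 - ∫ b, g b ∂ν)) ^ 2 / 2)
      = fun z => (g z.1 - g z.2) ^ 2 / 2 := by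
    funext z; ring
  rw [e] at h
  exact h

/-- **`E S² = σ²`**: the statistic `Σ_{i≠j} (g(x_i) − g(x_j))²/2 / (n(n−1))` is unbiased for
`σ² = ∫ (g − m)² dν` (`n ≥ 2`). [folklore] -/
theorem integral_sampleVar_iid (hxm : ∀ i, Measurable (x i)) (hind : iIndepFun x P)
    (hlaw : ∀ i, Measure.map (x i) P = ν) {g : X → ℝ} (hgm : Measurable g) (hg4 : MemLp g 4 ν)
    (hn : 2 ≤ n) :
    ∫ ω, (∑ z ∈ (univ : Finset (Fin n)).offDiag, (g (x z.1 ω) - g (x z.2 ω)) ^ 2 / 2)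
        / (n * (n - 1) : ℝ) ∂P
      = ∫ a, (g a - ∫ b, g b ∂ν) ^ 2 ∂ν := by
  haveI := isProbabilityMeasure_of_map_eq_iid (hxm ⟨0, by omega⟩) (hlaw ⟨0, by omega⟩)
  obtain ⟨hu4, hu0⟩ := centred_of_memLp_four (ν := ν) hg4
  have hFm : Measurable fun z : X × X => (g z.1 - g z.2) ^ 2 / 2 :=
    (((hgm.comp measurable_fst).sub (hgm.comp measurable_snd)).pow_const 2).div_const 2
  rw [integral_ustat₂_iid hxm hind hlaw (F := fun a b => (g a - g b) ^ 2 / 2) hFm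
      (memLp_halfSqDiff_two hgm hg4) hn, ← integral_halfSqDiff_centred hu4 hu0]
  refine integral_congr_ae (Filter.Eventually.of_forall fun z => ?_)
  simp only
  ring

/-- **The variance of the unbiased sample variance on a general space** (Cramér §27.4): for
`n ≥ 2` independent draws with common law `ν` and an observable `g ∈ L⁴(ν)`,
`Var[S²] = ((n − 1)μ₄ − (n − 3)σ⁴) / (n(n − 1))` with `σ² = ∫ (g − m)² dν`,
`μ₄ = ∫ (g − m)⁴ dν`, `m = ∫ g dν` — Hoeffding's law `(2ζ₂ + 4(n−2)ζ₁)/(n(n−1))` for the kernel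
`(g − g′)²/2`, whose `ζ₁ = (μ₄ − σ⁴)/4`, `ζ₂ = (μ₄ + σ⁴)/2`. [folklore] -/
theorem variance_sampleVar_iid (hxm : ∀ i, Measurable (x i)) (hind : iIndepFun x P)
    (hlaw : ∀ i, Measure.map (x i) P = ν) {g : X → ℝ} (hgm : Measurable g) (hg4 : MemLp g 4 ν)
    (hn : 2 ≤ n) :
    Var[fun ω => (∑ z ∈ (univ : Finset (Fin n)).offDiag, (g (x z.1 ω) - g (x z.2 ω)) ^ 2 / 2)
        / (n * (n - 1) : ℝ); P]
      = (((n : ℝ) - 1) * (∫ a, (g a - ∫ b, g b ∂ν) ^ 4 ∂ν)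
          - ((n : ℝ) - 3) * (∫ a, (g a - ∫ b, g b ∂ν) ^ 2 ∂ν) ^ 2) / (n * (n - 1)) := by
  haveI := isProbabilityMeasure_of_map_eq_iid (hxm ⟨0, by omega⟩) (hlaw ⟨0, by omega⟩)
  obtain ⟨hu4, hu0⟩ := centred_of_memLp_four (ν := ν) hg4
  have hFm : Measurable fun z : X × X => (g z.1 - g z.2) ^ 2 / 2 :=
    (((hgm.comp measurable_fst).sub (hgm.comp measurable_snd)).pow_const 2).div_const 2
  have hμ := integral_halfSqDiff_centred hu4 hu0
  have hc2 := integral_halfSqDiff_sq_centred hu4 hu0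
  have hc1 := integral_condMean_sq_centred hu4 hu0
  have hk : ∀ a b : X, ((g a - ∫ b, g b ∂ν) - (g b - ∫ b, g b ∂ν)) ^ 2 / 2 = (g a - g b) ^ 2 / 2 :=
    fun a b => by ring
  simp only [hk] at hμ hc2 hc1
  rw [variance_ustat₂_iid hxm hind hlaw (F := fun a b => (g a - g b) ^ 2 / 2) hFm
      (fun a b => by ring) (memLp_halfSqDiff_two hgm hg4) hn, hμ, hc2, hc1]
  have h2 : (2 : ℝ) ≤ n := by exact_mod_cast hn
  have hn0 : (n : ℝ) ≠ 0 := by positivity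
  have hn1 : (n : ℝ) - 1 ≠ 0 := (by linarith : (0 : ℝ) < n - 1).ne'
  field_simp
  ring

/-- **The same, split into two non-negative terms**: `Var[S²] = (μ₄ − σ⁴)/n + 2σ⁴/(n(n − 1))`.
[folklore] -/
theorem variance_sampleVar_iid' (hxm : ∀ i, Measurable (x i)) (hind : iIndepFun x P)
    (hlaw : ∀ i, Measure.map (x i) P = ν) {g : X → ℝ} (hgm : Measurable g) (hg4 : MemLp g 4 ν)
    (hn : 2 ≤ n) :
    Var[fun ω => (∑ z ∈ (univ : Finset (Fin n)).offDiag, (g (x z.1 ω) - g (x z.2 ω)) ^ 2 / 2)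
        / (n * (n - 1) : ℝ); P]
      = ((∫ a, (g a - ∫ b, g b ∂ν) ^ 4 ∂ν) - (∫ a, (g a - ∫ b, g b ∂ν) ^ 2 ∂ν) ^ 2) / n
          + 2 * (∫ a, (g a - ∫ b, g b ∂ν) ^ 2 ∂ν) ^ 2 / (n * (n - 1)) := by
  rw [variance_sampleVar_iid hxm hind hlaw hgm hg4 hn]
  have h2 : (2 : ℝ) ≤ n := by exact_mod_cast hn
  have hn0 : (n : ℝ) ≠ 0 := by positivity
  have hn1 : (n : ℝ) - 1 ≠ 0 := (by linarith : (0 : ℝ) < n - 1).ne'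
  field_simp
  ring

/-- **`σ⁴ ≤ μ₄`** on a general space (Jensen), read off `ζ₁ ≥ 0` for the kernel `(g − g′)²/2`
(`c₁ = (μ₄ + 3σ⁴)/4 ≥ μ_F² = σ⁴`). [folklore] -/
theorem sq_variance_le_fourthMoment [IsProbabilityMeasure ν] {g : X → ℝ} (hgm : Measurable g)
    (hg4 : MemLp g 4 ν) :
    (∫ a, (g a - ∫ b, g b ∂ν) ^ 2 ∂ν) ^ 2 ≤ ∫ a, (g a - ∫ b, g b ∂ν) ^ 4 ∂ν := by
  obtain ⟨hu4, hu0⟩ := centred_of_memLp_four (ν := ν) hg4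
  have hFm : Measurable fun z : X × X => (g z.1 - g z.2) ^ 2 / 2 :=
    (((hgm.comp measurable_fst).sub (hgm.comp measurable_snd)).pow_const 2).div_const 2
  have hμ := integral_halfSqDiff_centred hu4 hu0
  have hc1 := integral_condMean_sq_centred hu4 hu0
  have hk : ∀ a b : X, ((g a - ∫ b, g b ∂ν) - (g b - ∫ b, g b ∂ν)) ^ 2 / 2 = (g a - g b) ^ 2 / 2 :=
    fun a b => by ring
  simp only [hk] at hμ hc1
  have h := sq_kernelMean_le_condMeanSq (F := fun a b => (g a - g b) ^ 2 / 2) hFm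
    (memLp_halfSqDiff_two hgm hg4)
  rw [hμ, hc1] at h
  linarith

end SampleVar

end Summit.Ventures.LatticeQCDFlow.Scoring
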